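import Mathlib
import HarnessLib

/-!
# A discrete monotone-density theorem (helper file of crux `InverseSquareLaw`, stmt-CriticalPhenomena-4495)

Pure real analysis, no Ising input (route `InverseSquareTelemetry`, lead c3): the monotone density
theorem (Bingham–Goldie–Teugels, *Regular Variation*, Thm. 1.7.2) in discrete pure-power form.
`tendsto_diff_mul_rpow`: if `u n · n^ρ → c` and the differences `δ n = u n − u (n+1)` are eventually
non-increasing, then `δ n · n^{ρ+1} → c ρ` (telescoping gives `k δ(m+k) ≤ u m − u(m+k) ≤ k δ m`; with
`k = ⌊θn⌋` the bounds tend to `c(1 − (1+θ)^{−ρ})/θ`, `c((1−θ)^{−ρ} − 1)/θ`, both `→ cρ` as `θ → 0⁺`).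
Applied twice, `tendsto_secondDiff_mul_rpow`: with the second differences also eventually
non-increasing (both hold for Hausdorff moment sequences), `Δ²u(n) · n^{ρ+2} → cρ(ρ+1)` — the input of
`…AxialTelemetryFromPowerLaw`.
-/
noncomputable section

namespace Summit.CriticalPhenomena.Ising3DConformalLimit.Theorems

open Filter Topology Finset

namespace AxialTauberian

/-- Telescoping: `u m − u (m+k) = Σ_{i<k} (u (m+i) − u (m+i+1))`. [folklore] -/
theorem sub_eq_sum_diff (u : ℕ → ℝ) (m k : ℕ) :
    u m - u (m + k) = ∑ i ∈ range k, (u (m + i) - u (m + i + 1)) := by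
  induction k with
  | zero => simp
  | succ k ih =>
      rw [sum_range_succ, ← ih, show m + (k + 1) = m + k + 1 by ring]
      ring

/-- If the differences `δ j = u j − u (j+1)` are non-increasing on `[N, ∞)`, then for `N ≤ m`:
`k · δ (m+k) ≤ u m − u (m+k) ≤ k · δ m`. [folklore] -/
theorem diff_bounds {u : ℕ → ℝ} {N : ℕ}
    (hanti : ∀ i j, N ≤ i → i ≤ j → u j - u (j + 1) ≤ u i - u (i + 1)) {m : ℕ} (hm : N ≤ m) (k : ℕ) :
    (k : ℝ) * (u (m + k) - u (m + k + 1)) ≤ u m - u (m + k) ∧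
      u m - u (m + k) ≤ (k : ℝ) * (u m - u (m + 1)) := by
  rw [sub_eq_sum_diff u m k]
  constructor
  · have h : ∀ i ∈ range k, u (m + k) - u (m + k + 1) ≤ u (m + i) - u (m + i + 1) := by
      intro i hi
      have hi' := mem_range.1 hi
      exact hanti (m + i) (m + k) (by omega) (by omega)
    have := Finset.card_nsmul_le_sum (range k) (fun i => u (m + i) - u (m + i + 1)) _ h
    simpa [nsmul_eq_mul] using this
  · have h : ∀ i ∈ range k, u (m + i) - u (m + i + 1) ≤ u m - u (m + 1) := by
      intro i hi
      exact hanti m (m + i) hm (by omega)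
    have := Finset.sum_le_card_nsmul (range k) (fun i => u (m + i) - u (m + i + 1)) _ h
    simpa [nsmul_eq_mul] using this

/-- `(1 − (1+θ)^{−ρ})/θ → ρ` as `θ → 0`, `θ ≠ 0` (the derivative of `t ↦ (1+t)^{−ρ}` at `0` is `−ρ`).
[folklore] -/
theorem tendsto_lowerFn (ρ : ℝ) :
    Tendsto (fun θ : ℝ => (1 - (1 + θ) ^ (-ρ)) / θ) (𝓝[≠] 0) (𝓝 ρ) := by
  have hd : HasDerivAt (fun θ : ℝ => (1 + θ) ^ (-ρ)) (-ρ) 0 := by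
    have h1 : HasDerivAt (fun θ : ℝ => 1 + θ) 1 0 := by
      simpa using (hasDerivAt_id (0 : ℝ)).const_add 1
    have h2 := h1.rpow_const (p := -ρ) (Or.inl (by norm_num))
    simpa using h2
  have : Tendsto (fun t : ℝ => -(t⁻¹ * ((1 + (0 + t)) ^ (-ρ) - (1 + 0) ^ (-ρ)))) (𝓝[≠] 0) (𝓝 (- -ρ)) :=
    hd.tendsto_slope_zero.neg
  rw [neg_neg] at this
  refine this.congr' (Eventually.of_forall fun t => ?_)
  simp only [zero_add, add_zero, Real.one_rpow]
  rw [div_eq_inv_mul]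
  ring

/-- `((1−θ)^{−ρ} − 1)/θ → ρ` as `θ → 0`, `θ ≠ 0` (the derivative of `t ↦ (1−t)^{−ρ}` at `0` is `ρ`).
[folklore] -/
theorem tendsto_upperFn (ρ : ℝ) :
    Tendsto (fun θ : ℝ => ((1 - θ) ^ (-ρ) - 1) / θ) (𝓝[≠] 0) (𝓝 ρ) := by
  have hd : HasDerivAt (fun θ : ℝ => (1 - θ) ^ (-ρ)) ρ 0 := by
    have h1 : HasDerivAt (fun θ : ℝ => 1 - θ) (-1) 0 := by
      simpa using (hasDerivAt_id (0 : ℝ)).const_sub 1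
    have h2 := h1.rpow_const (p := -ρ) (Or.inl (by norm_num))
    simpa using h2
  have hs := hd.tendsto_slope_zero
  refine hs.congr' (Eventually.of_forall fun t => ?_)
  simp only [sub_zero, Real.one_rpow, zero_add, smul_eq_mul]
  rw [div_eq_inv_mul]

/-- `⌊θ n⌋ / n → θ` for `θ > 0`. [folklore] -/
theorem tendsto_floor_div {θ : ℝ} (hθ : 0 < θ) :
    Tendsto (fun n : ℕ => (⌊θ * n⌋₊ : ℝ) / (n : ℝ)) atTop (𝓝 θ) := by
  have h1 : Tendsto (fun n : ℕ => θ * (n : ℝ)) atTop atTop :=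
    Tendsto.const_mul_atTop hθ tendsto_natCast_atTop_atTop
  have h2 : Tendsto (fun n : ℕ => (⌊θ * (n : ℝ)⌋₊ : ℝ) / (θ * n)) atTop (𝓝 1) :=
    tendsto_nat_floor_div_atTop.comp h1
  have h3 : Tendsto (fun n : ℕ => θ * ((⌊θ * (n : ℝ)⌋₊ : ℝ) / (θ * n))) atTop (𝓝 (θ * 1)) :=
    h2.const_mul θ
  rw [mul_one] at h3
  refine h3.congr' ?_
  filter_upwards [eventually_gt_atTop 0] with n hn
  have hn' : (0 : ℝ) < n := by exact_mod_cast hn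
  field_simp

/-- **Forward comparison quotient.** With `k = ⌊θ n⌋`, `0 < θ`:
`(u n − u (n+k)) · n^{ρ+1} / k → c · (1 − (1+θ)^{−ρ})/θ`. [folklore] -/
theorem tendsto_forward {u : ℕ → ℝ} {ρ c θ : ℝ} (hθ : 0 < θ)
    (hu : Tendsto (fun n : ℕ => u n * (n : ℝ) ^ ρ) atTop (𝓝 c)) :
    Tendsto (fun n : ℕ => (u n - u (n + ⌊θ * n⌋₊)) * (n : ℝ) ^ (ρ + 1) / (⌊θ * n⌋₊ : ℝ)) atTop
      (𝓝 (c * ((1 - (1 + θ) ^ (-ρ)) / θ))) := by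
  obtain ⟨k, hk⟩ : ∃ k : ℕ → ℕ, ∀ n : ℕ, ⌊θ * (n : ℝ)⌋₊ = k n := ⟨_, fun _ => rfl⟩
  simp only [hk]
  -- ingredients
  have hkn : Tendsto (fun n : ℕ => (k n : ℝ) / (n : ℝ)) atTop (𝓝 θ) := by
    simpa only [hk] using tendsto_floor_div hθ
  have hφ : Tendsto (fun n : ℕ => n + k n) atTop atTop :=
    tendsto_atTop_mono (fun n => Nat.le_add_right n (k n)) tendsto_id
  have hB : Tendsto (fun n : ℕ => u (n + k n) * (((n + k n : ℕ) : ℝ)) ^ ρ) atTop (𝓝 c) := hu.comp hφ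
  -- the ratio `(n/(n+k))^ρ → (1+θ)^{-ρ}`
  have hratio : Tendsto (fun n : ℕ => ((n : ℝ) / ((n + k n : ℕ) : ℝ)) ^ ρ) atTop (𝓝 ((1 + θ) ^ (-ρ))) := by
    have h1 : Tendsto (fun n : ℕ => 1 + (k n : ℝ) / n) atTop (𝓝 (1 + θ)) := hkn.const_add 1
    have h2 : Tendsto (fun n : ℕ => (1 + (k n : ℝ) / n)⁻¹) atTop (𝓝 (1 + θ)⁻¹) :=
      h1.inv₀ (by linarith)
    have h3 : Tendsto (fun n : ℕ => ((1 + (k n : ℝ) / n)⁻¹) ^ ρ) atTop (𝓝 (((1 + θ)⁻¹) ^ ρ)) :=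
      h2.rpow_const (Or.inl (inv_ne_zero (by linarith)))
    rw [Real.inv_rpow (by linarith), ← Real.rpow_neg (by linarith)] at h3
    refine h3.congr' ?_
    filter_upwards [eventually_gt_atTop 0] with n hn
    have hn' : (0 : ℝ) < n := by exact_mod_cast hn
    congr 1
    push_cast
    field_simp
  -- `n/k → 1/θ`
  have hnk : Tendsto (fun n : ℕ => (n : ℝ) / (k n : ℝ)) atTop (𝓝 (1 / θ)) := by
    have := hkn.inv₀ hθ.ne'
    simpa [inv_div, one_div] using this
  -- assemble: quotient = (A n - B n * ratio n) * (n / k)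
  have hmain : Tendsto (fun n : ℕ => (u n * (n : ℝ) ^ ρ -
      (u (n + k n) * (((n + k n : ℕ) : ℝ)) ^ ρ) * (((n : ℝ) / ((n + k n : ℕ) : ℝ)) ^ ρ)) * ((n : ℝ) / (k n : ℝ)))
      atTop (𝓝 ((c - c * (1 + θ) ^ (-ρ)) * (1 / θ))) :=
    (hu.sub (hB.mul hratio)).mul hnk
  have hlim : (c - c * (1 + θ) ^ (-ρ)) * (1 / θ) = c * ((1 - (1 + θ) ^ (-ρ)) / θ) := by ring
  rw [hlim] at hmain
  refine hmain.congr' ?_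
  -- eventually `k n ≥ 1` and `n ≥ 1`
  have hk1 : ∀ᶠ n : ℕ in atTop, 1 ≤ k n := by
    have : Tendsto (fun n : ℕ => θ * (n : ℝ)) atTop atTop :=
      Tendsto.const_mul_atTop hθ tendsto_natCast_atTop_atTop
    filter_upwards [this.eventually_ge_atTop 1] with n hn
    rw [← hk]
    exact Nat.le_floor (by simpa using hn)
  filter_upwards [hk1, eventually_gt_atTop 0] with n hk1n hn
  have hn' : (0 : ℝ) < n := by exact_mod_cast hn
  have hkpos : (0 : ℝ) < k n := by exact_mod_cast hk1n
  have hm' : (0 : ℝ) < ((n + k n : ℕ) : ℝ) := by positivity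
  have hmρ : (((n + k n : ℕ) : ℝ)) ^ ρ ≠ 0 := (Real.rpow_pos_of_pos hm' ρ).ne'
  -- rewrite both `u` values through the power law
  have e1 : (n : ℝ) ^ (ρ + 1) = (n : ℝ) ^ ρ * n := by
    rw [Real.rpow_add hn', Real.rpow_one]
  have e2 : u (n + k n) * (((n + k n : ℕ) : ℝ)) ^ ρ * (((n : ℝ) / ((n + k n : ℕ) : ℝ)) ^ ρ) =
      u (n + k n) * (n : ℝ) ^ ρ := by
    rw [Real.div_rpow hn'.le hm'.le]
    field_simp
  rw [e2, e1]
  field_simp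

/-- **Backward comparison quotient.** With `k = ⌊θ n⌋`, `0 < θ < 1`:
`(u (n−k) − u n) · n^{ρ+1} / k → c · ((1−θ)^{−ρ} − 1)/θ`. [folklore] -/
theorem tendsto_backward {u : ℕ → ℝ} {ρ c θ : ℝ} (hθ : 0 < θ) (hθ1 : θ < 1)
    (hu : Tendsto (fun n : ℕ => u n * (n : ℝ) ^ ρ) atTop (𝓝 c)) :
    Tendsto (fun n : ℕ => (u (n - ⌊θ * n⌋₊) - u n) * (n : ℝ) ^ (ρ + 1) / (⌊θ * n⌋₊ : ℝ)) atTop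
      (𝓝 (c * (((1 - θ) ^ (-ρ) - 1) / θ))) := by
  obtain ⟨k, hk⟩ : ∃ k : ℕ → ℕ, ∀ n : ℕ, ⌊θ * (n : ℝ)⌋₊ = k n := ⟨_, fun _ => rfl⟩
  simp only [hk]
  have hkle : ∀ n : ℕ, k n ≤ n := fun n => by
    rw [← hk]
    refine Nat.floor_le_of_le ?_
    have : (0 : ℝ) ≤ n := Nat.cast_nonneg n
    nlinarith
  have hkn : Tendsto (fun n : ℕ => (k n : ℝ) / (n : ℝ)) atTop (𝓝 θ) := by
    simpa only [hk] using tendsto_floor_div hθ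
  -- `(n - k)/n → 1 - θ`, hence `n - k → ∞`
  have hfrac : Tendsto (fun n : ℕ => (((n - k n : ℕ) : ℝ)) / (n : ℝ)) atTop (𝓝 (1 - θ)) := by
    have h1 : Tendsto (fun n : ℕ => 1 - (k n : ℝ) / n) atTop (𝓝 (1 - θ)) := hkn.const_sub 1
    refine h1.congr' ?_
    filter_upwards [eventually_gt_atTop 0] with n hn
    have hn' : (0 : ℝ) < n := by exact_mod_cast hn
    rw [Nat.cast_sub (hkle n)]
    field_simp
  have hφ : Tendsto (fun n : ℕ => n - k n) atTop atTop := by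
    -- `(n - k n) ≥ (1-θ)/2 · n` eventually
    have hpos : 0 < (1 - θ) / 2 := by linarith
    have hev : ∀ᶠ n : ℕ in atTop, (1 - θ) / 2 * (n : ℝ) ≤ ((n - k n : ℕ) : ℝ) := by
      have h := hfrac.eventually (lt_mem_nhds (show (1 - θ) / 2 < 1 - θ by linarith))
      filter_upwards [h, eventually_gt_atTop 0] with n hn hn0
      have hn' : (0 : ℝ) < n := by exact_mod_cast hn0
      rw [lt_div_iff₀ hn'] at hn
      linarith
    have hT : Tendsto (fun n : ℕ => ((n - k n : ℕ) : ℝ)) atTop atTop :=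
      tendsto_atTop_mono' atTop hev (Tendsto.const_mul_atTop hpos tendsto_natCast_atTop_atTop)
    exact tendsto_natCast_atTop_iff.1 hT
  have hB : Tendsto (fun n : ℕ => u (n - k n) * (((n - k n : ℕ) : ℝ)) ^ ρ) atTop (𝓝 c) := hu.comp hφ
  have hratio : Tendsto (fun n : ℕ => ((n : ℝ) / ((n - k n : ℕ) : ℝ)) ^ ρ) atTop (𝓝 ((1 - θ) ^ (-ρ))) := by
    have h2 : Tendsto (fun n : ℕ => ((((n - k n : ℕ) : ℝ)) / (n : ℝ))⁻¹) atTop (𝓝 (1 - θ)⁻¹) :=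
      hfrac.inv₀ (by linarith)
    have h3 := h2.rpow_const (p := ρ) (Or.inl (inv_ne_zero (by linarith)))
    rw [Real.inv_rpow (by linarith), ← Real.rpow_neg (by linarith)] at h3
    refine h3.congr' (Eventually.of_forall fun n => ?_)
    simp only [inv_div]
  have hnk : Tendsto (fun n : ℕ => (n : ℝ) / (k n : ℝ)) atTop (𝓝 (1 / θ)) := by
    have := hkn.inv₀ hθ.ne'
    simpa [inv_div, one_div] using this
  have hmain : Tendsto (fun n : ℕ => ((u (n - k n) * (((n - k n : ℕ) : ℝ)) ^ ρ) *
      (((n : ℝ) / ((n - k n : ℕ) : ℝ)) ^ ρ) - u n * (n : ℝ) ^ ρ) * ((n : ℝ) / (k n : ℝ)))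
      atTop (𝓝 ((c * (1 - θ) ^ (-ρ) - c) * (1 / θ))) :=
    ((hB.mul hratio).sub hu).mul hnk
  have hlim : (c * (1 - θ) ^ (-ρ) - c) * (1 / θ) = c * (((1 - θ) ^ (-ρ) - 1) / θ) := by ring
  rw [hlim] at hmain
  refine hmain.congr' ?_
  have hk1 : ∀ᶠ n : ℕ in atTop, 1 ≤ k n := by
    have : Tendsto (fun n : ℕ => θ * (n : ℝ)) atTop atTop :=
      Tendsto.const_mul_atTop hθ tendsto_natCast_atTop_atTop
    filter_upwards [this.eventually_ge_atTop 1] with n hn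
    rw [← hk]
    exact Nat.le_floor (by simpa using hn)
  have hmpos : ∀ᶠ n : ℕ in atTop, 0 < n - k n := hφ.eventually_gt_atTop 0
  filter_upwards [hk1, eventually_gt_atTop 0, hmpos] with n hk1n hn hm
  have hn' : (0 : ℝ) < n := by exact_mod_cast hn
  have hkpos : (0 : ℝ) < k n := by exact_mod_cast hk1n
  have hm' : (0 : ℝ) < ((n - k n : ℕ) : ℝ) := by exact_mod_cast hm
  have hmρ : (((n - k n : ℕ) : ℝ)) ^ ρ ≠ 0 := (Real.rpow_pos_of_pos hm' ρ).ne'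
  have e1 : (n : ℝ) ^ (ρ + 1) = (n : ℝ) ^ ρ * n := by
    rw [Real.rpow_add hn', Real.rpow_one]
  have e2 : u (n - k n) * (((n - k n : ℕ) : ℝ)) ^ ρ * (((n : ℝ) / ((n - k n : ℕ) : ℝ)) ^ ρ) =
      u (n - k n) * (n : ℝ) ^ ρ := by
    rw [Real.div_rpow hn'.le hm'.le]
    field_simp
  rw [e2, e1]
  field_simp

/-- **Discrete monotone density theorem (pure-power form).** If `u n · n^ρ → c` (any real `ρ`, `c`)
and the differences `u n − u (n+1)` are non-increasing from some index on, then
`(u n − u (n+1)) · n^{ρ+1} → c ρ`. [cite: BinghamGoldieTeugels1987, Thm. 1.7.2 (monotone density theorem)] -/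
theorem tendsto_diff_mul_rpow {u : ℕ → ℝ} {ρ c : ℝ} {N : ℕ}
    (hu : Tendsto (fun n : ℕ => u n * (n : ℝ) ^ ρ) atTop (𝓝 c))
    (hanti : ∀ i j, N ≤ i → i ≤ j → u j - u (j + 1) ≤ u i - u (i + 1)) :
    Tendsto (fun n : ℕ => (u n - u (n + 1)) * (n : ℝ) ^ (ρ + 1)) atTop (𝓝 (c * ρ)) := by
  rw [Metric.tendsto_atTop]
  intro ε hε
  -- choose `θ ∈ (0, 1/2)` with both comparison constants within `ε/2` of `c ρ`
  have hL : Tendsto (fun θ : ℝ => c * ((1 - (1 + θ) ^ (-ρ)) / θ)) (𝓝[>] 0) (𝓝 (c * ρ)) :=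
    ((tendsto_lowerFn ρ).mono_left (nhdsWithin_mono _ (fun x hx => ne_of_gt hx))).const_mul c
  have hU : Tendsto (fun θ : ℝ => c * (((1 - θ) ^ (-ρ) - 1) / θ)) (𝓝[>] 0) (𝓝 (c * ρ)) :=
    ((tendsto_upperFn ρ).mono_left (nhdsWithin_mono _ (fun x hx => ne_of_gt hx))).const_mul c
  have hε2 : 0 < ε / 2 := half_pos hε
  have hθev : ∀ᶠ θ : ℝ in 𝓝[>] 0, dist (c * ((1 - (1 + θ) ^ (-ρ)) / θ)) (c * ρ) < ε / 2 ∧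
      dist (c * (((1 - θ) ^ (-ρ) - 1) / θ)) (c * ρ) < ε / 2 ∧ θ ∈ Set.Ioo (0 : ℝ) (1 / 2) :=
    (hL.eventually (Metric.ball_mem_nhds _ hε2)).and
      ((hU.eventually (Metric.ball_mem_nhds _ hε2)).and
        (Ioo_mem_nhdsGT (by norm_num : (0 : ℝ) < 1 / 2)))
  obtain ⟨θ, hθL, hθU, hθ0, hθ1⟩ := hθev.exists
  -- the two comparison quotients converge
  have hF := tendsto_forward (ρ := ρ) (c := c) hθ0 hu
  have hBk := tendsto_backward (ρ := ρ) (c := c) hθ0 (by linarith) hu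
  rw [Metric.tendsto_atTop] at hF hBk
  obtain ⟨N₁, hN₁⟩ := hF (ε / 2) hε2
  obtain ⟨N₂, hN₂⟩ := hBk (ε / 2) hε2
  -- thresholds: `k n ≥ 1`, `n - k n ≥ N`
  obtain ⟨k, hk⟩ : ∃ k : ℕ → ℕ, ∀ n : ℕ, ⌊θ * (n : ℝ)⌋₊ = k n := ⟨_, fun _ => rfl⟩
  simp only [hk] at hN₁ hN₂
  have hkle2 : ∀ n : ℕ, (k n : ℝ) ≤ θ * n := fun n => by
    rw [← hk]
    exact Nat.floor_le (mul_nonneg hθ0.le (Nat.cast_nonneg n))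
  obtain ⟨N₃, hN₃⟩ : ∃ N₃ : ℕ, ∀ n ≥ N₃, 1 ≤ k n ∧ N ≤ n - k n := by
    refine ⟨max (Nat.ceil (1 / θ)) (2 * N + 2), fun n hn => ?_⟩
    have hn1 : (Nat.ceil (1 / θ) : ℝ) ≤ n := by exact_mod_cast (le_max_left _ _).trans hn
    have hn2 : 2 * N + 2 ≤ n := (le_max_right _ _).trans hn
    have hθn : 1 ≤ θ * n := by
      have h := (Nat.le_ceil (1 / θ)).trans hn1
      rw [div_le_iff₀ hθ0] at h
      linarith
    refine ⟨by rw [← hk]; exact Nat.le_floor (by simpa using hθn), ?_⟩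
    have hkhalf : (k n : ℝ) ≤ n / 2 := by
      have := hkle2 n
      have hn0 : (0 : ℝ) ≤ n := Nat.cast_nonneg n
      nlinarith
    have hk' : 2 * k n ≤ n := by
      have : (2 * k n : ℝ) ≤ n := by linarith
      exact_mod_cast this
    omega
  refine ⟨max N₁ (max N₂ N₃), fun n hn => ?_⟩
  have hn₁ : N₁ ≤ n := (le_max_left _ _).trans hn
  have hn₂ : N₂ ≤ n := ((le_max_left _ _).trans (le_max_right _ _)).trans hn
  have hn₃ : N₃ ≤ n := ((le_max_right _ _).trans (le_max_right _ _)).trans hn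
  obtain ⟨hk1, hNk⟩ := hN₃ n hn₃
  have hkpos : (0 : ℝ) < k n := by exact_mod_cast hk1
  have hn0 : 0 < n := by
    have : k n ≤ n := by
      have h := hkle2 n
      have : (k n : ℝ) ≤ n := h.trans (by nlinarith [Nat.cast_nonneg (α := ℝ) n])
      exact_mod_cast this
    omega
  have hn' : (0 : ℝ) < n := by exact_mod_cast hn0
  have hpow : 0 < (n : ℝ) ^ (ρ + 1) := Real.rpow_pos_of_pos hn' _
  -- lower bound: k δ(n) ≥ ... from the forward block `[n, n+k]`: `k δ (n+k) ≤ u n - u (n+k) ≤ k δ n`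
  have hfwd := (diff_bounds hanti (m := n) (by omega) (k n)).2
  -- upper bound from the backward block `[n-k, n]`: `k δ n ≤ u (n-k) - u n`
  have hbwd' := (diff_bounds hanti (m := n - k n) hNk (k n)).1
  have hnk : n - k n + k n = n := Nat.sub_add_cancel (by
    have h := hkle2 n
    have : (k n : ℝ) ≤ n := h.trans (by nlinarith [Nat.cast_nonneg (α := ℝ) n])
    exact_mod_cast this)
  rw [hnk] at hbwd'
  -- convert to statements about `δ n · n^{ρ+1}`
  have hlow : (u n - u (n + k n)) * (n : ℝ) ^ (ρ + 1) / (k n : ℝ) ≤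
      (u n - u (n + 1)) * (n : ℝ) ^ (ρ + 1) := by
    rw [div_le_iff₀ hkpos]
    nlinarith
  have hup : (u n - u (n + 1)) * (n : ℝ) ^ (ρ + 1) ≤
      (u (n - k n) - u n) * (n : ℝ) ^ (ρ + 1) / (k n : ℝ) := by
    rw [le_div_iff₀ hkpos]
    nlinarith
  have h1 := hN₁ n hn₁
  have h2 := hN₂ n hn₂
  rw [Real.dist_eq] at h1 h2 hθL hθU ⊢
  rw [abs_sub_lt_iff] at h1 h2 hθL hθU ⊢
  constructor <;> linarith [hlow, hup, h1.1, h1.2, h2.1, h2.2, hθL.1, hθL.2, hθU.1, hθU.2]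

/-- **Second differences.** If `u n · n^ρ → c` (any real `ρ`, `c`), the first differences
`δ n = u n − u (n+1)` are eventually non-increasing AND the second differences
`Δ² n = u (n+1) + u (n−1) − 2 u n = δ (n−1) − δ n` are eventually non-increasing, then
`(u (n+1) + u (n-1) - 2 u n) · n^{ρ+2} → c ρ (ρ+1)`. (Both monotonicities hold for Hausdorff moment
sequences.) [cite: BinghamGoldieTeugels1987, Thm. 1.7.2 (monotone density theorem)] -/
theorem tendsto_secondDiff_mul_rpow {u : ℕ → ℝ} {ρ c : ℝ} {N : ℕ}
    (hu : Tendsto (fun n : ℕ => u n * (n : ℝ) ^ ρ) atTop (𝓝 c))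
    (hanti : ∀ i j, N ≤ i → i ≤ j → u j - u (j + 1) ≤ u i - u (i + 1))
    (hanti2 : ∀ i j, N ≤ i → i ≤ j →
      (u (j + 1) - u (j + 2)) - (u (j + 2) - u (j + 3)) ≤ (u (i + 1) - u (i + 2)) - (u (i + 2) - u (i + 3))) :
    Tendsto (fun n : ℕ => (u (n + 1) + u (n - 1) - 2 * u n) * (n : ℝ) ^ (ρ + 2)) atTop
      (𝓝 (c * ρ * (ρ + 1))) := by
  -- first differences: `δ n · n^{ρ+1} → c ρ`
  have h1 := tendsto_diff_mul_rpow hu hanti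
  -- apply the theorem to `v n = δ (n+1) = u (n+1) - u (n+2)` (shift keeps the power law)
  set v : ℕ → ℝ := fun n => u (n + 1) - u (n + 2) with hv
  have hv_pow : Tendsto (fun n : ℕ => v n * (n : ℝ) ^ (ρ + 1)) atTop (𝓝 (c * ρ)) := by
    -- `δ(n+1) (n+1)^{ρ+1} → cρ` and `(n/(n+1))^{ρ+1} → 1`
    have hs : Tendsto (fun n : ℕ => (u (n + 1) - u (n + 1 + 1)) * (((n + 1 : ℕ) : ℝ)) ^ (ρ + 1)) atTop
        (𝓝 (c * ρ)) := h1.comp (tendsto_add_atTop_nat 1)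
    have hr : Tendsto (fun n : ℕ => ((n : ℝ) / ((n + 1 : ℕ) : ℝ)) ^ (ρ + 1)) atTop (𝓝 1) := by
      have h : Tendsto (fun n : ℕ => (n : ℝ) / ((n + 1 : ℕ) : ℝ)) atTop (𝓝 1) := by
        have := tendsto_natCast_div_add_atTop (1 : ℝ)
        refine this.congr' (Eventually.of_forall fun n => ?_)
        push_cast; rfl
      have := h.rpow_const (p := ρ + 1) (Or.inl one_ne_zero)
      simpa using this
    have := hs.mul hr
    rw [mul_one] at this
    refine this.congr' ?_
    filter_upwards [eventually_gt_atTop 0] with n hn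
    have hn' : (0 : ℝ) < n := by exact_mod_cast hn
    have hm' : (0 : ℝ) < ((n + 1 : ℕ) : ℝ) := by positivity
    rw [hv, Real.div_rpow hn'.le hm'.le]
    field_simp
  have hv_anti : ∀ i j, N ≤ i → i ≤ j → v j - v (j + 1) ≤ v i - v (i + 1) := by
    intro i j hi hij
    simp only [hv]
    have := hanti2 i j hi hij
    ring_nf at this ⊢
    linarith
  have h2 := tendsto_diff_mul_rpow (ρ := ρ + 1) (c := c * ρ) hv_pow hv_anti
  -- `v n - v (n+1) = Δ²u (n+2)`: compare `n^{ρ+2}` with `(n+2)^{ρ+2}`, then shift back by `2`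
  have h3 : Tendsto (fun n : ℕ => (u (n + 2 + 1) + u (n + 2 - 1) - 2 * u (n + 2)) *
      (((n + 2 : ℕ) : ℝ)) ^ (ρ + 2)) atTop (𝓝 (c * ρ * (ρ + 1))) := by
    have hr : Tendsto (fun n : ℕ => ((((n + 2 : ℕ) : ℝ)) / (n : ℝ)) ^ (ρ + 1 + 1)) atTop (𝓝 1) := by
      have h : Tendsto (fun n : ℕ => (((n + 2 : ℕ) : ℝ)) / (n : ℝ)) atTop (𝓝 1) := by
        have h1' : Tendsto (fun n : ℕ => 1 + 2 / (n : ℝ)) atTop (𝓝 (1 + 0)) :=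
          (tendsto_const_nhds.div_atTop tendsto_natCast_atTop_atTop).const_add 1
        rw [add_zero] at h1'
        refine h1'.congr' ?_
        filter_upwards [eventually_gt_atTop 0] with n hn
        have hn' : (0 : ℝ) < n := by exact_mod_cast hn
        push_cast
        field_simp
      have := h.rpow_const (p := ρ + 1 + 1) (Or.inl one_ne_zero)
      simpa using this
    have := h2.mul hr
    rw [mul_one, show c * ρ * (ρ + 1) = c * ρ * (ρ + 1) from rfl] at this
    refine this.congr' ?_
    filter_upwards [eventually_gt_atTop 0] with n hn
    have hn' : (0 : ℝ) < n := by exact_mod_cast hn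
    have hm' : (0 : ℝ) < ((n + 2 : ℕ) : ℝ) := by positivity
    rw [Real.div_rpow hm'.le hn'.le, show ρ + 1 + 1 = ρ + 2 by ring,
      show n + 2 + 1 = n + 3 by ring, show n + 2 - 1 = n + 1 by omega]
    simp only [hv]
    field_simp
    ring
  -- undo the shift by 2
  have h4 := h3.comp (tendsto_sub_atTop_nat 2)
  refine h4.congr' ?_
  filter_upwards [eventually_ge_atTop 2] with n hn
  simp only [Function.comp_apply, Nat.sub_add_cancel hn]

end AxialTauberian

end Summit.CriticalPhenomena.Ising3DConformalLimit.Theorems
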